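import Summits.AtomisticToContinuum.FouriersLaw.Theorems.HonestZwanzigPositiveMemoryGreenKuboFloor
import Summits.AtomisticToContinuum.FouriersLaw.Theorems.HonestZwanzigMemoryConductivityBridges

/-!
# HonestZwanzig / PositiveMemory — the eventual Green–Kubo floor from NOT-INSULATING and from the summit
# (line `Sketch`, skeleton v10, stubs `stub_eventualFloor_of_conductanceLowerBound`, `stub_eventualFloor_of_fouriersLaw`)

Support file for crux item `stmt-AtomisticToContinuum-12694` (`HonestZwanzig.PositiveMemory`, sub-problem
`FouriersLaw`), line `Sketch`.

The EVENTUAL GREEN–KUBO FLOOR (EGKF) of the skeleton is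
`∃ κ > 0, ∃ N₀, ∀ N ≥ N₀, N ≥ 2: κ(N − 1) ≤ ∫₀^∞ corr_N(J,J)`, where
`corr_N(J,J)(t) = ∫ J·(P_t J) dμ_T − (∫ J dμ_T)²` is the equilibrium autocorrelation of the total current
`J = Σ_i j_i` of the open `N`-chain `pinnedChain ω₂ lam β γ` with both Langevin baths at temperature `T`.

* `stub_eventualFloor_of_conductanceLowerBound` — the shared sibling crux
  `JunctionLocality.ConductanceLowerBound` (item stmt-AtomisticToContinuum-11749) implies EGKF: this is the landed
  `greenKuboFloor_of_conductanceLowerBound` (`c·((N−1)T²) ≤ ∫₀^∞corr_N(J,J)` eventually) with `κ := c·T²`.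
* `stub_eventualFloor_of_fouriersLaw` — the sub-problem statement `FouriersLaw` implies EGKF: the landed
  `HonestZwanzig.memoryConductivity_of_fouriersLaw`, fed the landed Kundu–Dhar–Narayan identity
  `OddSectorIrreversibility.Corrector.openChainGreenKubo_holds`, gives `∫₀^∞corr_N(J,J)/(N−1) → k > 0`, whence the
  floor `κ := k/2` eventually (`tendsto_order`).

No definitions, no named facts, no `sorry`.
-/

noncomputable section

open MeasureTheory Filter Topology
open Literature.MathematicalPhysics.KineticTheory.HeatConduction

namespace Summit.AtomisticToContinuum.FouriersLaw.Theorems.HonestZwanzig.PositiveMemory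

/-- **Stub v10-C of line `Sketch` — the eventual Green–Kubo floor from NOT-INSULATING** (registered signature):
the sibling crux `JunctionLocality.ConductanceLowerBound` gives `κ(N − 1) ≤ ∫₀^∞ corr_N(J,J)` for all large
`N ≥ 2` with `κ = cT²`, by the landed `greenKuboFloor_of_conductanceLowerBound` (canonical unique steady-state
family + the Kundu–Dhar–Narayan identity `D_N = ∫₀^∞corr_N(J,J)/((N−1)T²)`). [cite: KunduDharNarayan2009, p. 3] -/
theorem stub_eventualFloor_of_conductanceLowerBound :
    Summit.AtomisticToContinuum.FouriersLaw.Theses.JunctionLocality.ConductanceLowerBound →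
    ∀ ω₂ lam β γ : ℝ, 0 < ω₂ → 0 < lam → 0 < β → 0 < γ → ∀ T : ℝ, 0 < T →
      ∃ κ : ℝ, 0 < κ ∧ ∃ N₀ : ℕ, ∀ N : ℕ, N₀ ≤ N → 2 ≤ N →
      let P := Literature.MathematicalPhysics.KineticTheory.HeatConduction.pinnedChain ω₂ lam β γ;
      let X := Literature.MathematicalPhysics.KineticTheory.HeatConduction.PhaseSpace N;
      let μ : MeasureTheory.Measure X := P.gibbsMeasure N T;
      let J : X → ℝ := fun z => ∑ i : Fin N, P.bondCurrent N i z;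
      κ * ((N : ℝ) - 1) ≤ ∫ t in Set.Ioi (0 : ℝ),
        ((∫ z, J z * (∫ y, J y ∂(P.transitionKernel N T T t.toNNReal z)) ∂μ) - (∫ z, J z ∂μ) * (∫ z, J z ∂μ)) := by
  -- adapted from `PositiveMemory_of_notInsulating` (…Theorems/HonestZwanzigPositiveMemoryNotInsulating.lean)
  intro hCLB ω₂ lam β γ hω hl hβ hγ T hT
  obtain ⟨c, hc, N₁, h⟩ := greenKuboFloor_of_conductanceLowerBound hCLB hω hl hβ hγ hT
  refine ⟨c * T ^ 2, by positivity, N₁, fun N hN1 hN2 => ?_⟩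
  have key := h N hN1 hN2
  dsimp only
  calc c * T ^ 2 * ((N : ℝ) - 1) = c * (((N : ℝ) - 1) * T ^ 2) := by ring
    _ ≤ _ := key

/-- **Stub v10-D of line `Sketch` — the eventual Green–Kubo floor is NECESSARY for the summit** (registered
signature): the sub-problem statement `FouriersLaw` gives `κ(N − 1) ≤ ∫₀^∞ corr_N(J,J)` for all large `N ≥ 2`.
The landed `HonestZwanzig.memoryConductivity_of_fouriersLaw`, fed the landed Kundu–Dhar–Narayan identity
`OddSectorIrreversibility.Corrector.openChainGreenKubo_holds`, yields `∫₀^∞corr_N(J,J)/(N − 1) → k > 0`; hence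
`∫₀^∞corr_N(J,J)/(N − 1) > k/2` eventually (`tendsto_order`), i.e. the floor with `κ = k/2`.
[cite: KunduDharNarayan2009, p. 3] -/
theorem stub_eventualFloor_of_fouriersLaw :
    _root_.FouriersLaw →
    ∀ ω₂ lam β γ : ℝ, 0 < ω₂ → 0 < lam → 0 < β → 0 < γ → ∀ T : ℝ, 0 < T →
      ∃ κ : ℝ, 0 < κ ∧ ∃ N₀ : ℕ, ∀ N : ℕ, N₀ ≤ N → 2 ≤ N →
      let P := Literature.MathematicalPhysics.KineticTheory.HeatConduction.pinnedChain ω₂ lam β γ;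
      let X := Literature.MathematicalPhysics.KineticTheory.HeatConduction.PhaseSpace N;
      let μ : MeasureTheory.Measure X := P.gibbsMeasure N T;
      let J : X → ℝ := fun z => ∑ i : Fin N, P.bondCurrent N i z;
      κ * ((N : ℝ) - 1) ≤ ∫ t in Set.Ioi (0 : ℝ),
        ((∫ z, J z * (∫ y, J y ∂(P.transitionKernel N T T t.toNNReal z)) ∂μ) - (∫ z, J z ∂μ) * (∫ z, J z ∂μ)) := by
  -- adapted from `PositiveMemory_of_memoryConductivity` (…Theorems/HonestZwanzigPositiveMemoryNotInsulating.lean)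
  intro hFL ω₂ lam β γ hω hl hβ hγ T hT
  have hMC : Summit.AtomisticToContinuum.FouriersLaw.Theses.HonestZwanzig.MemoryConductivity :=
    Summit.AtomisticToContinuum.FouriersLaw.Theorems.HonestZwanzig.memoryConductivity_of_fouriersLaw
      Summit.AtomisticToContinuum.FouriersLaw.Theorems.OddSectorIrreversibility.Corrector.openChainGreenKubo_holds
      hFL
  obtain ⟨k, hk, hlim⟩ := hMC ω₂ lam β γ hω hl hβ hγ T hT
  have hev := (tendsto_order.1 hlim).1 (k / 2) (by linarith)
  rw [Filter.eventually_atTop] at hev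
  obtain ⟨N₁, hN₁⟩ := hev
  refine ⟨k / 2, by positivity, N₁, fun N hN1 hN2 => ?_⟩
  have h := hN₁ N hN1
  dsimp only at h ⊢
  have hpos : (0 : ℝ) < (N : ℝ) - 1 := by
    have : (2 : ℝ) ≤ N := by exact_mod_cast hN2
    linarith
  rw [lt_div_iff₀ hpos] at h
  exact h.le

end Summit.AtomisticToContinuum.FouriersLaw.Theorems.HonestZwanzig.PositiveMemory

end
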